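import Summits.Ventures.PercRepro.ProfilePointedCircuitClassesStarSharpD0R

/-!
# PercRepro — CASE D0 OF `StarNineSharp`, PART S: REGIME (i) WITH A TRACE OF AT MOST TWO POINTS
(p5, gen 54; `proofs/P5-GM1.md` §81 ADD 7)

`inCount_thru_le_of_no_on_line_e_of_trace_le_two`: no ON line through `e`, an ON plane `H` through `e, f` whose
trace `T = H ∩ X` has at most two points. The demands on the `ef`-planes lie in `H` (`d0_demand_class'`), so the
R4b′ class (`¬ d0c0 ∧ ¬ d0c1 ∧ ¬ d0c4'`) has at most ONE element — two distinct pairs need three points of `T` —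
and its C-endpoint (`c_point_exists`) gives the ON target `{e, f, x} + b`; the R4a′ class is handled by
`d0_injR4a'` inside `inCount_thru_le_of_no_on_line_e_of_R4b_bound`.
-/

open scoped Matroid

namespace PercRepro.Cogirth

open Finset ThmH Skew Shadow Profile

open Classical

variable {α : Type} [DecidableEq α] {N : Matroid α} [N.Finite]

section StarSharpD0S

variable {b b' : α}

/-- A rank-3 subset of the ON plane `H` is ON: `ρ(S ∪ {b, b′}) = ρ(H ∪ {b, b′})`. -/
theorem rk_insert_bb'_eq_of_subset_H {H S : Finset α} (hS : S ⊆ H) (hS3 : rk N S = 3) (hH3 : rk N H = 3)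
    (hHon : rk N (insert b (insert b' H)) = 4) : rk N (insert b (insert b' S)) = 4 := by
  have h1 := rk_union_add_rk_le_of_subset_inter' (N := N) (S := H) (T := insert b (insert b' S)) (I := S)
    (by intro x hx; exact mem_inter.2 ⟨hS hx, mem_insert_of_mem (mem_insert_of_mem hx)⟩)
  have e1 : H ∪ insert b (insert b' S) = insert b (insert b' H) := by
    ext x; simp only [mem_union, mem_insert]
    constructor
    · rintro (hx | rfl | rfl | hx)
      · exact Or.inr (Or.inr hx)
      · exact Or.inl rfl
      · exact Or.inr (Or.inl rfl)
      · exact Or.inr (Or.inr (hS hx))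
    · rintro (rfl | rfl | hx)
      · exact Or.inr (Or.inl rfl)
      · exact Or.inr (Or.inr (Or.inl rfl))
      · exact Or.inl hx
  rw [e1, hS3, hH3, hHon] at h1
  have h2 : rk N (insert b (insert b' S)) ≤ rk N (insert b (insert b' H)) :=
    rk_mono' (M := N) (insert_subset_insert _ (insert_subset_insert _ hS))
  omega

/-- The C-endpoint of an R4b′ demand (`e` when there is none). -/
noncomputable def r4bPoint (N : Matroid α) [N.Finite] (b b' e f : α) (W : Finset α) : α :=
  if h : ∃ x ∈ (W.erase b).erase e, rk N {e, f, x} = 3 ∧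
      rk N ((((((gr N).erase b).erase b').erase f).erase e).erase x) = 4 then h.choose else e

/-- **REGIME (i) WITH `|H ∩ X| ≤ 2`**: no ON line through `e`, an ON plane `H` through `e, f` with at most two
points of `X`; then the `b′`-avoiding inequality holds. -/
theorem inCount_thru_le_of_no_on_line_e_of_trace_le_two (hn : (gr N).card = 9) (hR : rk N (gr N) = 5)
    (hcf : ∀ x ∈ gr N, rk N ((gr N).erase x) = 5) (h : SeriesPair N b b')
    {e f : α} (he : e ∈ gr N) (hf : f ∈ gr N) (hef : e ≠ f) (heb : e ≠ b) (heb' : e ≠ b') (hfb : f ≠ b) (hfb' : f ≠ b')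
    (hE7 : rk N (((gr N).erase b).erase b') = 4)
    (hnle : ∀ S : Finset α, S ⊆ ((gr N).erase b).erase b' → e ∈ S → rk N (insert b (insert b' S)) ≤ 3 → rk N S ≤ 1)
    (he1 : ∀ y ∈ ((((gr N).erase b).erase b').erase f).erase e, rk N {e, y} = 2)
    (hf1 : ∀ y ∈ ((((gr N).erase b).erase b').erase f).erase e, rk N {f, y} = 2)
    (hfc : ∀ y ∈ ((((gr N).erase b).erase b').erase f).erase e, rk N (((((gr N).erase b).erase b').erase f).erase y) = 4)
    (hX : rk N (((((gr N).erase b).erase b').erase f).erase e) = 4) (hef2 : rk N {e, f} = 2)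
    {H : Finset α} (hH : H ⊆ ((gr N).erase b).erase b') (heH : e ∈ H) (hfH : f ∈ H) (hH3 : rk N H = 3)
    (hHon : rk N (insert b (insert b' H)) = 4)
    (hHfl : ∀ z ∈ ((gr N).erase b).erase b', z ∉ H → rk N (insert z H) = 4)
    (hT2 : ((H.erase e).erase f).card ≤ 2) :
    inCount N 4 e + thruCount N 4 {b', f} + thruCount N 4 {b', e, f} ≤
      inCount N 4 f + thruCount N 4 {e, f} + thruCount N 4 {b', e} := by
  apply inCount_thru_le_of_no_on_line_e_of_R4b_bound hn hR hcf h he hf hef heb heb' hfb hfb' hE7 hnle he1 hfc hX hef2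
  have hb' : b' ∈ gr N := h.2.1; have hbb' : b ≠ b' := h.2.2.1
  have hXE : ((((gr N).erase b).erase b').erase f).erase e ⊆ ((gr N).erase b).erase b' :=
    (erase_subset _ _).trans (erase_subset _ _)
  have heX : e ∉ ((((gr N).erase b).erase b').erase f).erase e := fun h' => (mem_erase.1 h').1 rfl
  have hfX : f ∉ ((((gr N).erase b).erase b').erase f).erase e := fun h' => (mem_erase.1 (mem_erase.1 h').2).1 rfl
  have hdata := d0_demand_data h hn hf hef heb hfb hfb' (e := e)
  have hcls := d0_demand_class' h hR hE7 he hf heb heb' hfb hfb' hnle hef2 hH heH hfH hHon hHfl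
  set X := ((((gr N).erase b).erase b').erase f).erase e with hXdef
  -- the data of a demand of the class: its pair lies in the trace and has a C-endpoint
  have hcl : ∀ W ∈ biIndepSets N 4, ((e ∈ W ∧ f ∉ W) ∧ b' ∉ W) → ¬ (gr N \ W).erase b' ∈ biIndepSets N 4 →
      ¬ d0c0 N b b' e f W → ¬ d0c1 N b e f W →
      (W.erase b).erase e ⊆ (H.erase e).erase f ∧ ((W.erase b).erase e).card = 2 ∧
        r4bPoint N b b' e f W ∈ (W.erase b).erase e ∧ rk N {e, f, r4bPoint N b b' e f W} = 3 ∧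
        rk N (X.erase (r4bPoint N b b' e f W)) = 4 := by
    intro W hWs hPD hcW hnc₀ hnc₁
    obtain ⟨hbW, hπX, hπ2, hYeq, hWeq, hYr, hYc, hYon⟩ := hdata W hWs hPD hcW
    obtain ⟨hf3, hπH⟩ := hcls _ hπX hYr hYon hnc₁
    have hπT : (W.erase b).erase e ⊆ (H.erase e).erase f := by
      intro x hx
      exact mem_erase.2 ⟨fun h' => hfX (h' ▸ hπX hx), mem_erase.2 ⟨fun h' => heX (h' ▸ hπX hx),
        hπH (mem_insert_of_mem hx)⟩⟩
    have hres : ¬ (rk N (insert f ((W.erase b).erase e)) = 3 ∧ rk N (insert e (X \ (W.erase b).erase e)) = 4) := by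
      rintro ⟨h1, h2⟩
      apply hnc₀
      refine ⟨h1, h2, ?_⟩
      apply rk_insert_bb'_eq_of_subset_H (H := H) _ h1 hH3 hHon
      exact insert_subset hfH ((subset_insert _ _).trans hπH)
    obtain ⟨x, hxπ, hefx, hx4⟩ := c_point_exists h hn he hf hef heb heb' hfb hfb' hef2 he1 hf1 hX hπX hπ2 hYr hYc hres
    have hex : ∃ x ∈ (W.erase b).erase e, rk N {e, f, x} = 3 ∧ rk N (X.erase x) = 4 := ⟨x, hxπ, hefx, hx4⟩
    refine ⟨hπT, hπ2, ?_⟩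
    simp only [r4bPoint]
    split_ifs with h1
    · exact h1.choose_spec
    · exact absurd hex h1
  apply card_le_card_of_injOn (fun W => insert b {e, f, r4bPoint N b b' e f W})
  · intro W hW
    simp only [d0DON, mem_coe, mem_filter] at hW
    obtain ⟨⟨hWs, hPD, hcW⟩, ⟨hnc₀, hnc₁⟩, -⟩ := hW
    obtain ⟨hπT, -, hzπ, hefz, hz4⟩ := hcl W hWs hPD hcW hnc₀ hnc₁
    obtain ⟨-, hπX, -, -, -, -, -, -⟩ := hdata W hWs hPD hcW
    set z := r4bPoint N b b' e f W with hzdef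
    have hzX : z ∈ X := hπX hzπ
    have hze : z ≠ e := fun h' => heX (h' ▸ hzX)
    have hzf : z ≠ f := fun h' => hfX (h' ▸ hzX)
    have hzE := hXE hzX
    have hzH : z ∈ H := mem_of_mem_erase (mem_of_mem_erase (hπT hzπ))
    have hS : ({e, f, z} : Finset α) ⊆ ((gr N).erase b).erase b' := by
      intro w hw; simp only [mem_insert, mem_singleton] at hw
      rcases hw with rfl | rfl | rfl
      · exact mem_erase.2 ⟨heb', mem_erase.2 ⟨heb, he⟩⟩
      · exact mem_erase.2 ⟨hfb', mem_erase.2 ⟨hfb, hf⟩⟩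
      · exact hzE
    have hSH : ({e, f, z} : Finset α) ⊆ H := by
      intro w hw; simp only [mem_insert, mem_singleton] at hw
      rcases hw with rfl | rfl | rfl <;> assumption
    have hS3' : ({e, f, z} : Finset α).card = 3 := by
      rw [card_insert_of_notMem, card_pair hzf.symm]
      simp only [mem_insert, mem_singleton, not_or]; exact ⟨hef, hze.symm⟩
    have hon : rk N (insert b (insert b' {e, f, z})) = 4 := rk_insert_bb'_eq_of_subset_H hSH hefz hH3 hHon
    simp only [mem_coe, mem_filter]
    refine ⟨?_, ⟨mem_insert_of_mem (mem_insert_of_mem (mem_insert_self _ _)), ?_⟩,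
      mem_insert_of_mem (mem_insert_self _ _), mem_insert_self _ _, ?_⟩
    · rw [insert_b_mem_biIndepSets_iff h hn hS hS3', E7_sdiff_efx_eq]
      exact ⟨hefz, hz4⟩
    · intro h'
      simp only [mem_insert, mem_singleton] at h'
      rcases h' with h2 | h2 | h2 | h2
      · exact hbb' h2.symm
      · exact heb' h2.symm
      · exact hfb' h2.symm
      · exact (mem_erase.1 hzE).1 h2.symm
    · rw [off_image_efx_iff h hn he hf hef heb heb' hfb hfb' hzX]
      rintro ⟨-, h5⟩
      omega
  · intro W₁ hW₁ W₂ hW₂ _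
    simp only [d0DON, mem_coe, mem_filter] at hW₁ hW₂
    obtain ⟨hπT₁, hπ2₁, -, -, -⟩ := hcl W₁ hW₁.1.1 hW₁.1.2.1 hW₁.1.2.2 hW₁.2.1.1 hW₁.2.1.2
    obtain ⟨hπT₂, hπ2₂, -, -, -⟩ := hcl W₂ hW₂.1.1 hW₂.1.2.1 hW₂.1.2.2 hW₂.2.1.1 hW₂.2.1.2
    obtain ⟨-, -, -, hYeq₁, hWeq₁, -, -, -⟩ := hdata W₁ hW₁.1.1 hW₁.1.2.1 hW₁.1.2.2
    obtain ⟨-, -, -, hYeq₂, hWeq₂, -, -, -⟩ := hdata W₂ hW₂.1.1 hW₂.1.2.1 hW₂.1.2.2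
    -- two pairs of a trace with at most two points coincide
    have h1 : (W₁.erase b).erase e = (H.erase e).erase f :=
      eq_of_subset_of_card_le hπT₁ (by rw [hπ2₁]; exact hT2)
    have h2 : (W₂.erase b).erase e = (H.erase e).erase f :=
      eq_of_subset_of_card_le hπT₂ (by rw [hπ2₂]; exact hT2)
    rw [← hWeq₁, ← hWeq₂, ← hYeq₁, ← hYeq₂, h1, h2]

/-- The opposite vertex of an `ef`-plane demand in a 3-point trace (`e` when there is none). -/
noncomputable def oppPoint (N : Matroid α) [N.Finite] (b e f : α) (H W : Finset α) : α :=
  if h : ∃ t, t ∈ (H.erase e).erase f ∧ t ∉ (W.erase b).erase e then h.choose else e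

/-- **REGIME (i) WITH `|H ∩ X| = 3` AND C-POINT OPPOSITE VERTICES**: no ON line through `e`, an ON plane `H` through
`e, f` with three points of `X`, and every R4b′ demand (`¬ d0c0 ∧ ¬ d0c1 ∧ ¬ d0c4'`) has its opposite vertex
`t = T ∖ π` a C-point (`ρ{e, f, t} = 3`, `ρ(X − t) = 4`); then the `b′`-avoiding inequality holds — the opposite-vertex
map is injective (two pairs of a 3-set with the same complement coincide). -/
theorem inCount_thru_le_of_no_on_line_e_of_opp_C (hn : (gr N).card = 9) (hR : rk N (gr N) = 5)
    (hcf : ∀ x ∈ gr N, rk N ((gr N).erase x) = 5) (h : SeriesPair N b b')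
    {e f : α} (he : e ∈ gr N) (hf : f ∈ gr N) (hef : e ≠ f) (heb : e ≠ b) (heb' : e ≠ b') (hfb : f ≠ b) (hfb' : f ≠ b')
    (hE7 : rk N (((gr N).erase b).erase b') = 4)
    (hnle : ∀ S : Finset α, S ⊆ ((gr N).erase b).erase b' → e ∈ S → rk N (insert b (insert b' S)) ≤ 3 → rk N S ≤ 1)
    (he1 : ∀ y ∈ ((((gr N).erase b).erase b').erase f).erase e, rk N {e, y} = 2)
    (hfc : ∀ y ∈ ((((gr N).erase b).erase b').erase f).erase e, rk N (((((gr N).erase b).erase b').erase f).erase y) = 4)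
    (hX : rk N (((((gr N).erase b).erase b').erase f).erase e) = 4) (hef2 : rk N {e, f} = 2)
    {H : Finset α} (hH : H ⊆ ((gr N).erase b).erase b') (heH : e ∈ H) (hfH : f ∈ H) (hH3 : rk N H = 3)
    (hHon : rk N (insert b (insert b' H)) = 4)
    (hHfl : ∀ z ∈ ((gr N).erase b).erase b', z ∉ H → rk N (insert z H) = 4)
    (hT3 : ((H.erase e).erase f).card = 3)
    (hopp : ∀ W ∈ d0DON N b' e f, ¬ d0c0 N b b' e f W → ¬ d0c1 N b e f W → ¬ d0c4' N b b' e f W →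
      ∀ t ∈ (H.erase e).erase f, t ∉ (W.erase b).erase e →
        rk N {e, f, t} = 3 ∧ rk N ((((((gr N).erase b).erase b').erase f).erase e).erase t) = 4) :
    inCount N 4 e + thruCount N 4 {b', f} + thruCount N 4 {b', e, f} ≤
      inCount N 4 f + thruCount N 4 {e, f} + thruCount N 4 {b', e} := by
  apply inCount_thru_le_of_no_on_line_e_of_R4b_bound hn hR hcf h he hf hef heb heb' hfb hfb' hE7 hnle he1 hfc hX hef2
  have hb' : b' ∈ gr N := h.2.1; have hbb' : b ≠ b' := h.2.2.1
  have hXE : ((((gr N).erase b).erase b').erase f).erase e ⊆ ((gr N).erase b).erase b' :=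
    (erase_subset _ _).trans (erase_subset _ _)
  have heX : e ∉ ((((gr N).erase b).erase b').erase f).erase e := fun h' => (mem_erase.1 h').1 rfl
  have hfX : f ∉ ((((gr N).erase b).erase b').erase f).erase e := fun h' => (mem_erase.1 (mem_erase.1 h').2).1 rfl
  have hTX : (H.erase e).erase f ⊆ ((((gr N).erase b).erase b').erase f).erase e := by
    intro t ht
    exact mem_erase.2 ⟨(mem_erase.1 (mem_erase.1 ht).2).1, mem_erase.2 ⟨(mem_erase.1 ht).1,
      hH (mem_of_mem_erase (mem_of_mem_erase ht))⟩⟩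
  have hdata := d0_demand_data h hn hf hef heb hfb hfb' (e := e)
  have hcls := d0_demand_class' h hR hE7 he hf heb heb' hfb hfb' hnle hef2 hH heH hfH hHon hHfl
  set X := ((((gr N).erase b).erase b').erase f).erase e with hXdef
  set T := (H.erase e).erase f with hTdef
  -- the data of a demand of the class: its pair lies in the trace and the opposite vertex is a C-point
  have hcl : ∀ W ∈ biIndepSets N 4, ((e ∈ W ∧ f ∉ W) ∧ b' ∉ W) → ¬ (gr N \ W).erase b' ∈ biIndepSets N 4 →
      ¬ d0c0 N b b' e f W → ¬ d0c1 N b e f W → ¬ d0c4' N b b' e f W →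
      (W.erase b).erase e ⊆ T ∧ ((W.erase b).erase e).card = 2 ∧
        oppPoint N b e f H W ∈ T ∧ oppPoint N b e f H W ∉ (W.erase b).erase e ∧
        rk N {e, f, oppPoint N b e f H W} = 3 ∧ rk N (X.erase (oppPoint N b e f H W)) = 4 := by
    intro W hWs hPD hcW hnc₀ hnc₁ hnc₄
    obtain ⟨hbW, hπX, hπ2, hYeq, hWeq, hYr, hYc, hYon⟩ := hdata W hWs hPD hcW
    obtain ⟨hf3, hπH⟩ := hcls _ hπX hYr hYon hnc₁
    have hπT : (W.erase b).erase e ⊆ T := by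
      intro x hx
      exact mem_erase.2 ⟨fun h' => hfX (h' ▸ hπX hx), mem_erase.2 ⟨fun h' => heX (h' ▸ hπX hx),
        hπH (mem_insert_of_mem hx)⟩⟩
    have hex : ∃ t, t ∈ (H.erase e).erase f ∧ t ∉ (W.erase b).erase e := by
      by_contra hall
      push Not at hall
      have := card_le_card (show T ⊆ (W.erase b).erase e from fun t ht => hall t ht)
      omega
    have hWD : W ∈ d0DON N b' e f := by
      simp only [d0DON, mem_filter]; exact ⟨hWs, hPD, hcW⟩
    refine ⟨hπT, hπ2, ?_⟩
    simp only [oppPoint, dif_pos hex]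
    obtain ⟨ht, htπ⟩ := hex.choose_spec
    exact ⟨ht, htπ, hopp W hWD hnc₀ hnc₁ hnc₄ _ ht htπ⟩
  apply card_le_card_of_injOn (fun W => insert b {e, f, oppPoint N b e f H W})
  · intro W hW
    simp only [d0DON, mem_coe, mem_filter] at hW
    obtain ⟨⟨hWs, hPD, hcW⟩, ⟨hnc₀, hnc₁⟩, hnc₄⟩ := hW
    obtain ⟨-, -, hzT, -, hefz, hz4⟩ := hcl W hWs hPD hcW hnc₀ hnc₁ hnc₄
    set z := oppPoint N b e f H W with hzdef
    have hzX : z ∈ X := hTX hzT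
    have hze : z ≠ e := fun h' => heX (h' ▸ hzX)
    have hzf : z ≠ f := fun h' => hfX (h' ▸ hzX)
    have hzE := hXE hzX
    have hzH : z ∈ H := mem_of_mem_erase (mem_of_mem_erase hzT)
    have hS : ({e, f, z} : Finset α) ⊆ ((gr N).erase b).erase b' := by
      intro w hw; simp only [mem_insert, mem_singleton] at hw
      rcases hw with rfl | rfl | rfl
      · exact mem_erase.2 ⟨heb', mem_erase.2 ⟨heb, he⟩⟩
      · exact mem_erase.2 ⟨hfb', mem_erase.2 ⟨hfb, hf⟩⟩
      · exact hzE
    have hSH : ({e, f, z} : Finset α) ⊆ H := by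
      intro w hw; simp only [mem_insert, mem_singleton] at hw
      rcases hw with rfl | rfl | rfl <;> assumption
    have hS3' : ({e, f, z} : Finset α).card = 3 := by
      rw [card_insert_of_notMem, card_pair hzf.symm]
      simp only [mem_insert, mem_singleton, not_or]; exact ⟨hef, hze.symm⟩
    have hon : rk N (insert b (insert b' {e, f, z})) = 4 := rk_insert_bb'_eq_of_subset_H hSH hefz hH3 hHon
    simp only [mem_coe, mem_filter]
    refine ⟨?_, ⟨mem_insert_of_mem (mem_insert_of_mem (mem_insert_self _ _)), ?_⟩,
      mem_insert_of_mem (mem_insert_self _ _), mem_insert_self _ _, ?_⟩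
    · rw [insert_b_mem_biIndepSets_iff h hn hS hS3', E7_sdiff_efx_eq]
      exact ⟨hefz, hz4⟩
    · intro h'
      simp only [mem_insert, mem_singleton] at h'
      rcases h' with h2 | h2 | h2 | h2
      · exact hbb' h2.symm
      · exact heb' h2.symm
      · exact hfb' h2.symm
      · exact (mem_erase.1 hzE).1 h2.symm
    · rw [off_image_efx_iff h hn he hf hef heb heb' hfb hfb' hzX]
      rintro ⟨-, h5⟩
      omega
  · intro W₁ hW₁ W₂ hW₂ heq
    simp only [d0DON, mem_coe, mem_filter] at hW₁ hW₂
    obtain ⟨hπT₁, hπ2₁, hz₁T, hz₁π, -, -⟩ := hcl W₁ hW₁.1.1 hW₁.1.2.1 hW₁.1.2.2 hW₁.2.1.1 hW₁.2.1.2 hW₁.2.2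
    obtain ⟨hπT₂, hπ2₂, hz₂T, hz₂π, -, -⟩ := hcl W₂ hW₂.1.1 hW₂.1.2.1 hW₂.1.2.2 hW₂.2.1.1 hW₂.2.1.2 hW₂.2.2
    obtain ⟨-, -, -, hYeq₁, hWeq₁, -, -, -⟩ := hdata W₁ hW₁.1.1 hW₁.1.2.1 hW₁.1.2.2
    obtain ⟨-, -, -, hYeq₂, hWeq₂, -, -, -⟩ := hdata W₂ hW₂.1.1 hW₂.1.2.1 hW₂.1.2.2
    have heq' : insert b ({e, f, oppPoint N b e f H W₁} : Finset α) = insert b {e, f, oppPoint N b e f H W₂} := heq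
    -- the opposite vertices agree
    have hz : oppPoint N b e f H W₁ = oppPoint N b e f H W₂ := by
      have hz₁X := hTX hz₁T
      have hz₁E := hXE hz₁X
      have hm : oppPoint N b e f H W₁ ∈ insert b ({e, f, oppPoint N b e f H W₂} : Finset α) := by
        rw [← heq']
        exact mem_insert_of_mem (mem_insert_of_mem (mem_insert_of_mem (mem_singleton_self _)))
      simp only [mem_insert, mem_singleton] at hm
      rcases hm with h2 | h2 | h2 | h2
      · exact absurd h2 (mem_erase.1 (mem_erase.1 hz₁E).2).1
      · exact absurd h2 (fun h' => heX (h' ▸ hz₁X))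
      · exact absurd h2 (fun h' => hfX (h' ▸ hz₁X))
      · exact h2
    -- two pairs of a 3-set with the same complement coincide
    have h1 : (W₁.erase b).erase e = T.erase (oppPoint N b e f H W₁) :=
      eq_of_subset_of_card_le (fun x hx => mem_erase.2 ⟨fun h' => hz₁π (h' ▸ hx), hπT₁ hx⟩)
        (by rw [card_erase_of_mem hz₁T, hT3, hπ2₁])
    have h2 : (W₂.erase b).erase e = T.erase (oppPoint N b e f H W₂) :=
      eq_of_subset_of_card_le (fun x hx => mem_erase.2 ⟨fun h' => hz₂π (h' ▸ hx), hπT₂ hx⟩)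
        (by rw [card_erase_of_mem hz₂T, hT3, hπ2₂])
    rw [← hWeq₁, ← hWeq₂, ← hYeq₁, ← hYeq₂, h1, h2, hz]

/-- **REGIME (i) WITH AT MOST ONE R4b′ DEMAND**: no ON line through `e`, an ON plane `H` through `e, f`, and the
R4b′ class (`¬ d0c0 ∧ ¬ d0c1 ∧ ¬ d0c4'`) has at most one element; then the `b′`-avoiding inequality holds (the
C-endpoint target of that demand). Together with `inCount_thru_le_of_no_on_line_e_of_opp_C` this leaves, in the
no-ON-line-through-`e` regime, only the configurations with two R4b′ demands one of which has a non-C opposite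
vertex (the type-δ configurations of §81 ADD 3). -/
theorem inCount_thru_le_of_no_on_line_e_of_one_R4b (hn : (gr N).card = 9) (hR : rk N (gr N) = 5)
    (hcf : ∀ x ∈ gr N, rk N ((gr N).erase x) = 5) (h : SeriesPair N b b')
    {e f : α} (he : e ∈ gr N) (hf : f ∈ gr N) (hef : e ≠ f) (heb : e ≠ b) (heb' : e ≠ b') (hfb : f ≠ b) (hfb' : f ≠ b')
    (hE7 : rk N (((gr N).erase b).erase b') = 4)
    (hnle : ∀ S : Finset α, S ⊆ ((gr N).erase b).erase b' → e ∈ S → rk N (insert b (insert b' S)) ≤ 3 → rk N S ≤ 1)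
    (he1 : ∀ y ∈ ((((gr N).erase b).erase b').erase f).erase e, rk N {e, y} = 2)
    (hf1 : ∀ y ∈ ((((gr N).erase b).erase b').erase f).erase e, rk N {f, y} = 2)
    (hfc : ∀ y ∈ ((((gr N).erase b).erase b').erase f).erase e, rk N (((((gr N).erase b).erase b').erase f).erase y) = 4)
    (hX : rk N (((((gr N).erase b).erase b').erase f).erase e) = 4) (hef2 : rk N {e, f} = 2)
    {H : Finset α} (hH : H ⊆ ((gr N).erase b).erase b') (heH : e ∈ H) (hfH : f ∈ H) (hH3 : rk N H = 3)
    (hHon : rk N (insert b (insert b' H)) = 4)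
    (hHfl : ∀ z ∈ ((gr N).erase b).erase b', z ∉ H → rk N (insert z H) = 4)
    (hone : ∀ W₁ ∈ d0DON N b' e f, ∀ W₂ ∈ d0DON N b' e f,
      ¬ d0c0 N b b' e f W₁ → ¬ d0c1 N b e f W₁ → ¬ d0c4' N b b' e f W₁ →
      ¬ d0c0 N b b' e f W₂ → ¬ d0c1 N b e f W₂ → ¬ d0c4' N b b' e f W₂ → W₁ = W₂) :
    inCount N 4 e + thruCount N 4 {b', f} + thruCount N 4 {b', e, f} ≤
      inCount N 4 f + thruCount N 4 {e, f} + thruCount N 4 {b', e} := by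
  apply inCount_thru_le_of_no_on_line_e_of_R4b_bound hn hR hcf h he hf hef heb heb' hfb hfb' hE7 hnle he1 hfc hX hef2
  have hb' : b' ∈ gr N := h.2.1; have hbb' : b ≠ b' := h.2.2.1
  have hXE : ((((gr N).erase b).erase b').erase f).erase e ⊆ ((gr N).erase b).erase b' :=
    (erase_subset _ _).trans (erase_subset _ _)
  have heX : e ∉ ((((gr N).erase b).erase b').erase f).erase e := fun h' => (mem_erase.1 h').1 rfl
  have hfX : f ∉ ((((gr N).erase b).erase b').erase f).erase e := fun h' => (mem_erase.1 (mem_erase.1 h').2).1 rfl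
  have hdata := d0_demand_data h hn hf hef heb hfb hfb' (e := e)
  have hcls := d0_demand_class' h hR hE7 he hf heb heb' hfb hfb' hnle hef2 hH heH hfH hHon hHfl
  set X := ((((gr N).erase b).erase b').erase f).erase e with hXdef
  apply card_le_card_of_injOn (fun W => insert b {e, f, r4bPoint N b b' e f W})
  · intro W hW
    simp only [d0DON, mem_coe, mem_filter] at hW
    obtain ⟨⟨hWs, hPD, hcW⟩, ⟨hnc₀, hnc₁⟩, -⟩ := hW
    obtain ⟨hbW, hπX, hπ2, hYeq, hWeq, hYr, hYc, hYon⟩ := hdata W hWs hPD hcW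
    obtain ⟨hf3, hπH⟩ := hcls _ hπX hYr hYon hnc₁
    have hres : ¬ (rk N (insert f ((W.erase b).erase e)) = 3 ∧ rk N (insert e (X \ (W.erase b).erase e)) = 4) := by
      rintro ⟨h1, h2⟩
      apply hnc₀
      refine ⟨h1, h2, ?_⟩
      apply rk_insert_bb'_eq_of_subset_H (H := H) _ h1 hH3 hHon
      exact insert_subset hfH ((subset_insert _ _).trans hπH)
    obtain ⟨x, hxπ, hefx, hx4⟩ := c_point_exists h hn he hf hef heb heb' hfb hfb' hef2 he1 hf1 hX hπX hπ2 hYr hYc hres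
    have hex : ∃ x ∈ (W.erase b).erase e, rk N {e, f, x} = 3 ∧ rk N (X.erase x) = 4 := ⟨x, hxπ, hefx, hx4⟩
    have hzd : r4bPoint N b b' e f W ∈ (W.erase b).erase e ∧ rk N {e, f, r4bPoint N b b' e f W} = 3 ∧
        rk N (X.erase (r4bPoint N b b' e f W)) = 4 := by
      simp only [r4bPoint]
      split_ifs with h1
      · exact h1.choose_spec
      · exact absurd hex h1
    obtain ⟨hzπ, hefz, hz4⟩ := hzd
    set z := r4bPoint N b b' e f W with hzdef
    have hzX : z ∈ X := hπX hzπ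
    have hze : z ≠ e := fun h' => heX (h' ▸ hzX)
    have hzf : z ≠ f := fun h' => hfX (h' ▸ hzX)
    have hzE := hXE hzX
    have hzH : z ∈ H := hπH (mem_insert_of_mem hzπ)
    have hS : ({e, f, z} : Finset α) ⊆ ((gr N).erase b).erase b' := by
      intro w hw; simp only [mem_insert, mem_singleton] at hw
      rcases hw with rfl | rfl | rfl
      · exact mem_erase.2 ⟨heb', mem_erase.2 ⟨heb, he⟩⟩
      · exact mem_erase.2 ⟨hfb', mem_erase.2 ⟨hfb, hf⟩⟩
      · exact hzE
    have hSH : ({e, f, z} : Finset α) ⊆ H := by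
      intro w hw; simp only [mem_insert, mem_singleton] at hw
      rcases hw with rfl | rfl | rfl <;> assumption
    have hS3' : ({e, f, z} : Finset α).card = 3 := by
      rw [card_insert_of_notMem, card_pair hzf.symm]
      simp only [mem_insert, mem_singleton, not_or]; exact ⟨hef, hze.symm⟩
    have hon : rk N (insert b (insert b' {e, f, z})) = 4 := rk_insert_bb'_eq_of_subset_H hSH hefz hH3 hHon
    simp only [mem_coe, mem_filter]
    refine ⟨?_, ⟨mem_insert_of_mem (mem_insert_of_mem (mem_insert_self _ _)), ?_⟩,
      mem_insert_of_mem (mem_insert_self _ _), mem_insert_self _ _, ?_⟩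
    · rw [insert_b_mem_biIndepSets_iff h hn hS hS3', E7_sdiff_efx_eq]
      exact ⟨hefz, hz4⟩
    · intro h'
      simp only [mem_insert, mem_singleton] at h'
      rcases h' with h2 | h2 | h2 | h2
      · exact hbb' h2.symm
      · exact heb' h2.symm
      · exact hfb' h2.symm
      · exact (mem_erase.1 hzE).1 h2.symm
    · rw [off_image_efx_iff h hn he hf hef heb heb' hfb hfb' hzX]
      rintro ⟨-, h5⟩
      omega
  · intro W₁ hW₁ W₂ hW₂ _
    simp only [mem_coe, mem_filter] at hW₁ hW₂
    exact hone W₁ hW₁.1 W₂ hW₂.1 hW₁.2.1.1 hW₁.2.1.2 hW₁.2.2 hW₂.2.1.1 hW₂.2.1.2 hW₂.2.2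

end StarSharpD0S

end PercRepro.Cogirth
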